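import Mathlib
import Literature.Analysis.OperatorTheory.ContractiveDetComplexity
import Literature.Analysis.OperatorTheory.ContractiveDeterminantalRepresentations
import Summits.ValiantsHypothesis.ValiantsHypothesis.Theorems.ContractivityPricePriceOfContractivityStubOneLargeClassSchur
import Summits.ValiantsHypothesis.ValiantsHypothesis.Theorems.ContractivityPricePriceOfContractivityStubOneLargeClassBounds
import Summits.ValiantsHypothesis.ValiantsHypothesis.Theorems.ContractivityPricePriceOfContractivityStubOneLargeClass
import Summits.ValiantsHypothesis.ValiantsHypothesis.Theorems.ContractivityPricePriceOfContractivityStubSameSizeSingleColour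
import HarnessLib

/-!
# Stub `stubN_assembly` of line `birth` (crux `ContractivityPrice.PriceOfContractivity`,
item stmt-ValiantsHypothesis-10583) — piece N4 of the weighted model-space colligation

**Assembly of NH₁ for one colour class plus one singleton.**  Hypotheses: the statements of the
pieces N1 (`stubN_cauchyCoeff`: Cauchy's estimate for the Taylor coefficients of `b/a`), N2
(`stubN_gramStein`: the Gram matrix `Gp` of the weighted model space, positive definite, with its
`tsum` formula and the Stein identity) and N3 (`stubN_contraction`: the colligation
`K' = [[−T S T⁻¹, √2 · T (Ŝφ)], [−(1/√2) e₀ᵀ T⁻¹, φ₀]]` is a contraction) VERBATIM.  Conclusion: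
the registered shape of `stub_normHalvingOne` under the profile hypothesis
`∃ x, Nat.card {i // κ i ≠ x} ≤ 1`, with `c = 2` (`R' = R + 2 ≤ 16 R`).

## Proof

Block indexing (`assembly_blockIndex_le_one`): `Fin R ≃ Fin n ⊕ Fin t`, the `x`-rows first,
`t ≤ 1`.  If `t = 0` the pencil is one-coloured and the landed
`SingleColour.stub_sameSize_singleColour` re-realises it at the same size with norm `≤ 1/2`.
If `t = 1`, with blocks `[[A, B], [C, D]]` the pencil determinant is `P = â + b̂ · X_y`
(`y = c 0 ≠ x`, `a = det (1 + ξA)`, `b` the bordered determinant, hat = substitution `ξ ↦ X_x`;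
landed `schur_eval_pencil_fromBlocks`, `eval_bordPoly`, `schur_eq_of_eval_eq`).  Zero-freeness on
the closed polydisc of radius `2` gives `a ≠ 0` and, by Vieta (`bnd_norm_le_of_linear_ne_zero`),
`|b| ≤ |a|/2` on `|ξ| ≤ 2`; compactness bounds `1/|a|` there.  N1 (twice) bounds the Taylor
coefficients of `b/a` by `2^{-k-1}` and of `1/a` geometrically; N2 at `N = n + 1` produces `Gp`;
for `φ` the coefficient vector of `b` the `tsum` formula gives
`re (φ* Gp φ) = Σ_k |(b/a)^(k)|² 2^k ≤ Σ_k ¼ 2^{-k} = ½`; N3 produces `T` and the contraction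
`K'`.  Its pencil determinant is computed pointwise (`det_pencil_colligation`): the state block
satisfies `1 + ξ(−TST⁻¹) = T (1 − ξS) T⁻¹`, so `det = det (1 − ξS) = a(ξ)` EXACTLY (landed
`OneLargeClass.piece_d_shift`), and the `1 × 1` Schur complement is
`1 + y (b₀ + ξ ((1 − ξS)⁻¹ b̃)₀) = 1 + y · b(ξ)/a(ξ)` (the `T`'s and the `√2`'s cancel; landed shift
identity), whence `det = a(ξ) + y b(ξ)`; the polynomial identity follows off the zero set of `â`
(`schur_eq_of_eval_eq`) and survives reindexing (`det_pencil_reindex`).  Folklore linear algebra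
over the landed pieces; no cited facts; no definitions.
-/

noncomputable section

-- D-0017: a single-problem summit is `Summits/<S>/<S>/…` with namespace `Summit.<S>.<S>.…` by design.
set_option linter.dupNamespace false

namespace Summit.ValiantsHypothesis.ValiantsHypothesis.Theorems.PriceOfContractivity.NormHalvingModelSpace

open Matrix
open Literature.Analysis.OperatorTheory (eval_det_one_add_diagonal_mul_map_C det_pencil_reindex)
open Summit.ValiantsHypothesis.ValiantsHypothesis.Theorems.PriceOfContractivity.OneLargeClass

/-! ### Linear-algebra helpers for the colligation -/

/-- A `1 × 1` product `row(u) · X · col(w)` is the scalar `u ⬝ (X w)`. [folklore] -/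
theorem replicateRow_mul_mul_replicateCol_apply {m : Type*} [Fintype m] (u w : m → ℂ)
    (X : Matrix m m ℂ) (i j : Fin 1) :
    (Matrix.replicateRow (Fin 1) u * X * Matrix.replicateCol (Fin 1) w) i j = u ⬝ᵥ (X *ᵥ w) := by
  rw [Matrix.mul_assoc, Matrix.mul_apply]
  simp only [Matrix.replicateRow_apply, Matrix.mul_apply, Matrix.replicateCol_apply, dotProduct,
    Matrix.mulVec]

/-- The state block of the colligation: `1 + ξ (−T S T⁻¹) = T (1 − ξ S) T⁻¹`. [folklore] -/
theorem colligation_one_add_smul_stateBlock {N : ℕ} (T S : Matrix (Fin (N + 1)) (Fin (N + 1)) ℂ)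
    (hT : IsUnit T.det) (ξ : ℂ) :
    1 + ξ • (-(T * S * T⁻¹)) = T * (1 - ξ • S) * T⁻¹ := by
  rw [Matrix.mul_sub, Matrix.sub_mul, Matrix.mul_one, Matrix.mul_nonsing_inv T hT,
    Matrix.mul_smul, Matrix.smul_mul, smul_neg, sub_eq_add_neg]

/-- Inverse of a conjugate: `(T M T⁻¹)⁻¹ = T M⁻¹ T⁻¹` for invertible `T`. [folklore] -/
theorem colligation_inv_conj {N : ℕ} (T M : Matrix (Fin (N + 1)) (Fin (N + 1)) ℂ)
    (hT : IsUnit T.det) :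
    (T * M * T⁻¹)⁻¹ = T * M⁻¹ * T⁻¹ := by
  rw [Matrix.mul_inv_rev, Matrix.mul_inv_rev, Matrix.nonsing_inv_nonsing_inv T hT,
    Matrix.mul_assoc]

/-- **Pencil determinant of the colligation.**  For `a(0) = 1`, `deg a, deg b ≤ N + 1`, `φ` the
coefficient vector of `b` and any invertible `T`, the Sylvester pencil of
`[[−T S T⁻¹, √2 · T b̃], [−(1/√2) e₀ᵀ T⁻¹, b₀]]` (`S` the companion matrix of `a`,
`b̃_k = b_{k+1} − b₀ a_{k+1}`) coloured `(x, …, x, y)` has determinant `â + b̂ · X_y`: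
pointwise, `det (1 + ξ(−TST⁻¹)) = det (1 − ξS) = a(ξ)` and the Schur complement is
`1 + y (b₀ + ξ ((1 − ξS)⁻¹ b̃)₀) = 1 + y b(ξ)/a(ξ)` by the landed shift identity
`OneLargeClass.piece_d_shift`. [folklore] -/
theorem det_pencil_colligation {σ : Type} (x y : σ) (N : ℕ) (a b : Polynomial ℂ)
    (φ : Fin (N + 2) → ℂ) (T : Matrix (Fin (N + 1)) (Fin (N + 1)) ℂ)
    (ha0 : a.coeff 0 = 1) (ha : a.natDegree ≤ N + 1) (hb : b.natDegree ≤ N + 1)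
    (hφ : ∀ j, φ j = b.coeff j) (hT : IsUnit T.det) :
    (1 + Matrix.diagonal (fun i => MvPolynomial.X (Sum.elim (fun _ => x) (fun _ => y) i)) *
        (Matrix.fromBlocks
            (-(T * Matrix.of (fun i j : Fin (N + 1) =>
                if (j : ℕ) = 0 then -a.coeff ((i : ℕ) + 1) else if (i : ℕ) + 1 = (j : ℕ) then (1 : ℂ) else 0) * T⁻¹))
            (Matrix.replicateCol (Fin 1)
              ((Real.sqrt 2 : ℂ) • (T *ᵥ (fun k : Fin (N + 1) => φ k.succ - φ 0 * a.coeff ((k : ℕ) + 1)))))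
            (Matrix.replicateRow (Fin 1) (-(((Real.sqrt 2 : ℝ) : ℂ)⁻¹ • (T⁻¹ 0))))
            (φ 0 • (1 : Matrix (Fin 1) (Fin 1) ℂ))).map
          (fun a : ℂ => (MvPolynomial.C a : MvPolynomial σ ℂ))).det =
      Polynomial.aeval (MvPolynomial.X x : MvPolynomial σ ℂ) a +
        Polynomial.aeval (MvPolynomial.X x : MvPolynomial σ ℂ) b * MvPolynomial.X y := by
  classical
  obtain ⟨S, hS⟩ : ∃ S : Matrix (Fin (N + 1)) (Fin (N + 1)) ℂ,
      S = Matrix.of (fun i j : Fin (N + 1) => if (j : ℕ) = 0 then -a.coeff ((i : ℕ) + 1)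
        else if (i : ℕ) + 1 = (j : ℕ) then (1 : ℂ) else 0) :=
    ⟨_, rfl⟩
  obtain ⟨w, hw⟩ : ∃ w : Fin (N + 1) → ℂ,
      w = fun k : Fin (N + 1) => φ k.succ - φ 0 * a.coeff ((k : ℕ) + 1) := ⟨_, rfl⟩
  rw [← hS, ← hw]
  have hTu : IsUnit T := (Matrix.isUnit_iff_isUnit_det T).mpr hT
  have ha_sum : ∀ ξ : ℂ, ∑ j ∈ Finset.range (N + 2), a.coeff j * ξ ^ j = a.eval ξ := fun ξ =>
    (Polynomial.eval_eq_sum_range' (by omega) ξ).symm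
  have hb_sum : ∀ ξ : ℂ, ∑ j ∈ Finset.range (N + 2), b.coeff j * ξ ^ j = b.eval ξ := fun ξ =>
    (Polynomial.eval_eq_sum_range' (by omega) ξ).symm
  have ha0' : a.eval 0 ≠ 0 := by rw [← Polynomial.coeff_zero_eq_eval_zero, ha0]; exact one_ne_zero
  have hr2 : ((Real.sqrt 2 : ℝ) : ℂ) ≠ 0 := by exact_mod_cast (Real.sqrt_pos.mpr two_pos).ne'
  refine schur_eq_of_eval_eq x a ha0' fun z hz => ?_
  obtain ⟨hdet, hreal⟩ := piece_d_shift N (fun j => a.coeff j) ha0 (z x)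
  rw [← hS] at hdet hreal
  have hconj : 1 + z x • (-(T * S * T⁻¹)) = T * (1 - z x • S) * T⁻¹ :=
    colligation_one_add_smul_stateBlock T S hT (z x)
  have hdetA : (1 + z x • (-(T * S * T⁻¹))).det = a.eval (z x) := by
    rw [hconj, Matrix.det_conj hTu, hdet, ha_sum]
  have hAne : (1 + z x • (-(T * S * T⁻¹))).det ≠ 0 := by rw [hdetA]; exact hz
  have hinv : (1 + z x • (-(T * S * T⁻¹)))⁻¹ = T * (1 - z x • S)⁻¹ * T⁻¹ := by
    rw [hconj, colligation_inv_conj T _ hT]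
  -- evaluate the pencil
  rw [eval_det_one_add_diagonal_mul_map_C]
  have hdiag : (fun i => z (Sum.elim (fun _ => x) (fun _ => y) i)) =
      Sum.elim (fun _ : Fin (N + 1) => z x) (fun _ : Fin 1 => z y) := by
    funext i; rcases i with i | j <;> rfl
  rw [hdiag, schur_one_add_diagonal_mul_fromBlocks,
    schur_det_blocks_pointwise _ _ _ _ _ _ hAne, hdetA, hinv, Matrix.det_fin_one]
  -- the Schur complement entry
  have hentry : (Matrix.replicateRow (Fin 1) (-(((Real.sqrt 2 : ℝ) : ℂ)⁻¹ • (T⁻¹ 0))) *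
      (T * (1 - z x • S)⁻¹ * T⁻¹) *
      Matrix.replicateCol (Fin 1) ((Real.sqrt 2 : ℂ) • (T *ᵥ w))) 0 0 =
      -(((1 - z x • S)⁻¹ *ᵥ w) 0) := by
    rw [replicateRow_mul_mul_replicateCol_apply, Matrix.mulVec_smul, Matrix.mulVec_mulVec,
      Matrix.nonsing_inv_mul_cancel_right _ _ hT, dotProduct_smul, neg_dotProduct, smul_dotProduct]
    have h1 : ∀ v : Fin (N + 1) → ℂ, T⁻¹ 0 ⬝ᵥ v = (T⁻¹ *ᵥ v) 0 := fun v => rfl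
    rw [h1, Matrix.mulVec_mulVec, Matrix.nonsing_inv_mul_cancel_left _ _ hT, smul_eq_mul,
      smul_eq_mul, ← mul_neg, ← mul_assoc, mul_inv_cancel₀ hr2, one_mul]
  have hshift := hreal (by rw [ha_sum]; exact hz) (fun k => b.coeff k)
  rw [ha_sum, hb_sum] at hshift
  have hw' : w = fun k : Fin (N + 1) => b.coeff ((k : ℕ) + 1) - b.coeff 0 * a.coeff ((k : ℕ) + 1) := by
    rw [hw]; funext k; simp only [hφ, Fin.val_succ, Fin.val_zero]
  rw [← hw'] at hshift
  simp only [Matrix.add_apply, Matrix.one_apply_eq, Matrix.diagonal_mul, Matrix.sub_apply,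
    Matrix.smul_apply, smul_eq_mul, hentry, map_add, map_mul, schur_eval_aeval_X,
    MvPolynomial.eval_X, mul_neg, sub_neg_eq_add, ← hshift, hφ, Fin.val_zero]
  field_simp
  ring

/-! ### Block indexing, compactness, the geometric sum -/

/-- Block indexing: if all but at most one index carry the colour `x`, then
`Fin R ≃ Fin n ⊕ Fin t` with `t ≤ 1`, the first block coloured `x` and the second block coloured
by `c : Fin t → σ` with `c j ≠ x` (the `≤ 1` variant of the landed
`OneLargeClass.piece_a_blockIndex`). [folklore] -/
theorem assembly_blockIndex_le_one :
    ∀ {σ : Type} {R : ℕ} (κ : Fin R → σ) (x : σ), Nat.card {i : Fin R // κ i ≠ x} ≤ 1 →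
      ∃ (n t : ℕ) (e : Fin R ≃ Fin n ⊕ Fin t) (c : Fin t → σ),
        t ≤ 1 ∧ (∀ j, c j ≠ x) ∧ ∀ i, κ (e.symm i) = Sum.elim (fun _ => x) c i := by
  intro σ R κ x h
  classical
  let p : Fin R → Prop := fun i => κ i = x
  have ht : Fintype.card {i // ¬p i} ≤ 1 := by
    rwa [Nat.card_eq_fintype_card] at h
  let eX : {i // p i} ≃ Fin (Fintype.card {i // p i}) := Fintype.equivFin _
  let eF : {i // ¬p i} ≃ Fin (Fintype.card {i // ¬p i}) := Fintype.equivFin _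
  let e : Fin R ≃ Fin (Fintype.card {i // p i}) ⊕ Fin (Fintype.card {i // ¬p i}) :=
    (Equiv.sumCompl p).symm.trans (eX.sumCongr eF)
  refine ⟨_, _, e, fun j => κ (eF.symm j), ht, fun j => (eF.symm j).2, ?_⟩
  rintro (i | j)
  · show κ (Equiv.sumCompl p ((eX.sumCongr eF).symm (Sum.inl i))) = x
    rw [Equiv.sumCongr_symm, Equiv.sumCongr_apply, Sum.map_inl, Equiv.sumCompl_apply_inl]
    exact (eX.symm i).2
  · show κ (Equiv.sumCompl p ((eX.sumCongr eF).symm (Sum.inr j))) = κ (eF.symm j)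
    rw [Equiv.sumCongr_symm, Equiv.sumCongr_apply, Sum.map_inr, Equiv.sumCompl_apply_inr]

/-- Compactness: a polynomial without zeros on the closed disc `|ξ| ≤ 2` is bounded below there, so
`|1| ≤ C |a(ξ)|`. [folklore] -/
theorem assembly_exists_inv_bound (a : Polynomial ℂ) (ha : ∀ ξ : ℂ, ‖ξ‖ ≤ 2 → a.eval ξ ≠ 0) :
    ∃ C : ℝ, ∀ ξ : ℂ, ‖ξ‖ ≤ 2 → ‖(1 : Polynomial ℂ).eval ξ‖ ≤ C * ‖a.eval ξ‖ := by
  obtain ⟨ξ₀, hξ₀, hmin⟩ := (isCompact_closedBall (0 : ℂ) 2).exists_isMinOn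
    ⟨0, Metric.mem_closedBall_self (by norm_num)⟩ (a.continuous.norm.continuousOn)
  have hδ : 0 < ‖a.eval ξ₀‖ := norm_pos_iff.mpr (ha ξ₀ (mem_closedBall_zero_iff.mp hξ₀))
  refine ⟨‖a.eval ξ₀‖⁻¹, fun ξ hξ => ?_⟩
  have hle : ‖a.eval ξ₀‖ ≤ ‖a.eval ξ‖ := isMinOn_iff.mp hmin ξ (mem_closedBall_zero_iff.mpr hξ)
  rw [Polynomial.eval_one, norm_one]
  calc (1 : ℝ) = ‖a.eval ξ₀‖⁻¹ * ‖a.eval ξ₀‖ := (inv_mul_cancel₀ hδ.ne').symm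
    _ ≤ ‖a.eval ξ₀‖⁻¹ * ‖a.eval ξ‖ := by gcongr

/-- The geometric sum: `0 ≤ f_k ≤ ½ · 2^{-k}` gives `Σ_k f_k² 2^k ≤ Σ_k ¼ 2^{-k} = ½`. [folklore] -/
theorem assembly_tsum_le_half (f : ℕ → ℝ) (hf0 : ∀ k, 0 ≤ f k) (hf : ∀ k, f k ≤ (1 / 2) / 2 ^ k)
    (hs : Summable (fun k : ℕ => f k ^ 2 * 2 ^ k)) :
    ∑' k : ℕ, f k ^ 2 * 2 ^ k ≤ 1 / 2 := by
  have hg : Summable (fun k : ℕ => (1 / 4 : ℝ) * (1 / 2) ^ k) :=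
    (summable_geometric_of_lt_one (by norm_num) (by norm_num)).mul_left _
  have hle : ∀ k : ℕ, f k ^ 2 * 2 ^ k ≤ (1 / 4 : ℝ) * (1 / 2) ^ k := by
    intro k
    have h2 : (0 : ℝ) < 2 ^ k := by positivity
    have h3 : f k ^ 2 ≤ ((1 / 2) / 2 ^ k) ^ 2 := pow_le_pow_left₀ (hf0 k) (hf k) 2
    calc f k ^ 2 * 2 ^ k ≤ ((1 / 2) / 2 ^ k) ^ 2 * 2 ^ k := mul_le_mul_of_nonneg_right h3 h2.le
      _ = (1 / 4 : ℝ) * (1 / 2) ^ k := by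
          rw [_root_.one_div_pow]
          field_simp
          ring
  calc ∑' k : ℕ, f k ^ 2 * 2 ^ k ≤ ∑' k : ℕ, (1 / 4 : ℝ) * (1 / 2) ^ k :=
        Summable.tsum_le_tsum hle hs hg
    _ = (1 / 4 : ℝ) * (1 - 1 / 2)⁻¹ := by
        rw [tsum_mul_left, tsum_geometric_of_lt_one (by norm_num) (by norm_num)]
    _ = 1 / 2 := by norm_num

/-! ### The registered piece -/

/-- **Piece N4 (assembly of NH₁ for one colour class + one singleton; crux `PriceOfContractivity`,
line `birth`, stub `stubN_assembly`).**  Hypotheses: the statements of N1 (`stubN_cauchyCoeff`),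
N2 (`stubN_gramStein`), N3 (`stubN_contraction`) verbatim.  Conclusion: the registered shape of
`stub_normHalvingOne` with the extra profile hypothesis `∃ x, Nat.card {i // κ i ≠ x} ≤ 1`, with
`c = 2` (size `R' = R + 2 ≤ 16 R`).  Route: block indexing (`x`-rows first, `t ≤ 1` foreign rows;
`t = 0` is the landed single-colour case `SingleColour.stub_sameSize_singleColour`); Schur
expansion `P = â + b̂ X_y` (`deg b ≤ n + 1`); Vieta `|b| ≤ |a|/2` on `|ξ| ≤ 2` (landed
`bnd_norm_le_of_linear_ne_zero`); compactness bound for `1/a`; N1 twice (for `b` with `M = 1/2`,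
for `1` with `M = C`); N2 at `N = n + 1`; `φ = ` coefficient vector of `b`,
`re (φ* Gp φ) ≤ Σ ¼·4^{-k}·2^k = ½`; N3; the pencil identity `det_pencil_colligation`;
reindexing. [folklore assembly] -/
theorem stubN_assembly :
    (∀ (a b : Polynomial ℂ) (M : ℝ), a.coeff 0 = 1 →
      (∀ ξ : ℂ, ‖ξ‖ ≤ 2 → a.eval ξ ≠ 0) →
      (∀ ξ : ℂ, ‖ξ‖ ≤ 2 → ‖b.eval ξ‖ ≤ M * ‖a.eval ξ‖) →
      ∀ k : ℕ, ‖PowerSeries.coeff k ((b : PowerSeries ℂ) * (a : PowerSeries ℂ)⁻¹)‖ ≤ M / 2 ^ k) →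
    (∀ (N : ℕ) (a : Polynomial ℂ), a.coeff 0 = 1 → a.natDegree ≤ N + 1 →
      (∃ C : ℝ, ∀ m : ℕ, ‖PowerSeries.coeff m ((a : PowerSeries ℂ)⁻¹)‖ ≤ C / 2 ^ m) →
      ∃ Gp : Matrix (Fin (N + 2)) (Fin (N + 2)) ℂ, Gp.IsHermitian ∧
        (∀ v : Fin (N + 2) → ℂ, v ≠ 0 → 0 < RCLike.re (star v ⬝ᵥ (Gp *ᵥ v))) ∧
        (∀ v : Fin (N + 2) → ℂ,
          Summable (fun k : ℕ => ‖PowerSeries.coeff k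
              (((∑ j : Fin (N + 2), Polynomial.monomial (j : ℕ) (v j) : Polynomial ℂ) : PowerSeries ℂ) *
                (a : PowerSeries ℂ)⁻¹)‖ ^ 2 * 2 ^ k) ∧
          star v ⬝ᵥ (Gp *ᵥ v) = ((∑' k : ℕ, ‖PowerSeries.coeff k
              (((∑ j : Fin (N + 2), Polynomial.monomial (j : ℕ) (v j) : Polynomial ℂ) : PowerSeries ℂ) *
                (a : PowerSeries ℂ)⁻¹)‖ ^ 2 * 2 ^ k : ℝ) : ℂ)) ∧
        (∀ v : Fin (N + 2) → ℂ,
          star v ⬝ᵥ (Gp *ᵥ v) =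
            2 * (star (fun k : Fin (N + 1) => v k.succ - v 0 * a.coeff ((k : ℕ) + 1)) ⬝ᵥ
              ((Gp.submatrix Fin.castSucc Fin.castSucc) *ᵥ
                (fun k : Fin (N + 1) => v k.succ - v 0 * a.coeff ((k : ℕ) + 1)))) +
            ((‖v 0‖ ^ 2 : ℝ) : ℂ))) →
    (∀ (N : ℕ) (a : Polynomial ℂ) (Gp : Matrix (Fin (N + 2)) (Fin (N + 2)) ℂ) (φ : Fin (N + 2) → ℂ),
      Gp.IsHermitian → (∀ v : Fin (N + 2) → ℂ, v ≠ 0 → 0 < RCLike.re (star v ⬝ᵥ (Gp *ᵥ v))) →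
      (∀ v : Fin (N + 2) → ℂ,
          star v ⬝ᵥ (Gp *ᵥ v) =
            2 * (star (fun k : Fin (N + 1) => v k.succ - v 0 * a.coeff ((k : ℕ) + 1)) ⬝ᵥ
              ((Gp.submatrix Fin.castSucc Fin.castSucc) *ᵥ
                (fun k : Fin (N + 1) => v k.succ - v 0 * a.coeff ((k : ℕ) + 1)))) +
            ((‖v 0‖ ^ 2 : ℝ) : ℂ)) →
      RCLike.re (star φ ⬝ᵥ (Gp *ᵥ φ)) ≤ 1 / 2 →
      ∃ (T : Matrix (Fin (N + 1)) (Fin (N + 1)) ℂ) (K' : Matrix (Fin (N + 1 + 1)) (Fin (N + 1 + 1)) ℂ),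
        IsUnit T.det ∧
        K' = Matrix.reindex finSumFinEquiv finSumFinEquiv
            (Matrix.fromBlocks
              (-(T * Matrix.of (fun i j : Fin (N + 1) =>
                  if (j : ℕ) = 0 then -a.coeff ((i : ℕ) + 1) else if (i : ℕ) + 1 = (j : ℕ) then (1 : ℂ) else 0) * T⁻¹))
              (Matrix.replicateCol (Fin 1)
                ((Real.sqrt 2 : ℂ) • (T *ᵥ (fun k : Fin (N + 1) => φ k.succ - φ 0 * a.coeff ((k : ℕ) + 1)))))
              (Matrix.replicateRow (Fin 1) (-(((Real.sqrt 2 : ℝ) : ℂ)⁻¹ • (T⁻¹ 0))))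
              (φ 0 • (1 : Matrix (Fin 1) (Fin 1) ℂ))) ∧
        ‖Matrix.toEuclideanCLM (𝕜 := ℂ) K'‖ ≤ 1) →
    ∃ c : ℕ, ∀ (n R : ℕ) {σ : Type} [Fintype σ] (K : Matrix (Fin R) (Fin R) ℂ) (κ : Fin R → σ),
      (∃ x : σ, Nat.card {i : Fin R // κ i ≠ x} ≤ 1) →
      R ≤ 2 ^ ((Nat.log 2 n + c + 2) ^ (c + 2)) →
      Fintype.card σ ≤ n →
      (1 + Matrix.diagonal (fun i => MvPolynomial.X (κ i)) * K.map (fun a : ℂ => (MvPolynomial.C a : MvPolynomial σ ℂ))).det.totalDegree ≤ n →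
      ‖Matrix.toEuclideanCLM (𝕜 := ℂ) K‖ ≤ 2 →
      (∀ z : σ → ℂ, (∀ j, ‖z j‖ ≤ 2) → MvPolynomial.eval z (1 + Matrix.diagonal (fun i => MvPolynomial.X (κ i)) * K.map (fun a : ℂ => (MvPolynomial.C a : MvPolynomial σ ℂ))).det ≠ 0) →
      ∃ R' ≤ 2 ^ ((Nat.log 2 n + c) ^ c) * R, ∃ (K' : Matrix (Fin R') (Fin R') ℂ) (κ' : Fin R' → σ),
        ‖Matrix.toEuclideanCLM (𝕜 := ℂ) K'‖ ≤ 1 ∧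
        (1 + Matrix.diagonal (fun i => MvPolynomial.X (κ i)) * K.map (fun a : ℂ => (MvPolynomial.C a : MvPolynomial σ ℂ))).det =
          (1 + Matrix.diagonal (fun i => MvPolynomial.X (κ' i)) * K'.map (fun a : ℂ => (MvPolynomial.C a : MvPolynomial σ ℂ))).det := by
  intro hN1 hN2 hN3
  classical
  refine ⟨2, ?_⟩
  intro n R σ _ K κ hx _ _ _ _ hz
  obtain ⟨x, hx⟩ := hx
  have h16 : 16 ≤ 2 ^ ((Nat.log 2 n + 2) ^ 2) := by
    calc 16 = 2 ^ (2 ^ 2) := by norm_num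
      _ ≤ 2 ^ ((Nat.log 2 n + 2) ^ 2) :=
          Nat.pow_le_pow_right (by norm_num) (Nat.pow_le_pow_left (by omega) 2)
  -- (a₀) block indexing: `x`-rows first, `t ≤ 1` foreign rows
  obtain ⟨n', t, e, c, ht, hc, hκ⟩ := assembly_blockIndex_le_one κ x hx
  have hRt : R = n' + t := by
    simpa [Fintype.card_fin, Fintype.card_sum] using Fintype.card_congr e
  obtain rfl | rfl : t = 0 ∨ t = 1 := by omega
  · -- `t = 0`: one colour, the landed single-colour case
    have hall : ∀ i, κ i = x := by
      intro i
      have h := hκ (e i)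
      rw [e.symm_apply_apply] at h
      rw [h]
      rcases e i with _ | j
      · rfl
      · exact j.elim0
    obtain ⟨K₁, κ₁, hK₁, hdet⟩ :=
      SingleColour.stub_sameSize_singleColour R K κ (fun i j => by rw [hall i, hall j]) hz
    refine ⟨R, ?_, K₁, κ₁, hK₁.trans (by norm_num), hdet⟩
    calc R = 1 * R := (one_mul R).symm
      _ ≤ 2 ^ ((Nat.log 2 n + 2) ^ 2) * R := Nat.mul_le_mul_right R (by omega)
  -- `t = 1`: one foreign row of colour `c 0 ≠ x`
  set K₀ : Matrix (Fin n' ⊕ Fin 1) (Fin n' ⊕ Fin 1) ℂ := Matrix.reindex e e K with hK₀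
  set P := (1 + Matrix.diagonal (fun i => MvPolynomial.X (κ i)) *
      K.map (fun a : ℂ => (MvPolynomial.C a : MvPolynomial σ ℂ))).det with hPdef
  have hP0 : P = (1 + Matrix.diagonal (fun i => MvPolynomial.X (Sum.elim (fun _ => x) c i)) *
      (Matrix.fromBlocks K₀.toBlocks₁₁ K₀.toBlocks₁₂ K₀.toBlocks₂₁ K₀.toBlocks₂₂).map
        (fun a : ℂ => (MvPolynomial.C a : MvPolynomial σ ℂ))).det := by
    rw [Matrix.fromBlocks_toBlocks, hK₀, hPdef, ← det_pencil_reindex e K κ]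
    simp only [hκ]
  set A := K₀.toBlocks₁₁ with hA
  set B := K₀.toBlocks₁₂ with hB
  set C := K₀.toBlocks₂₁ with hC
  set D := K₀.toBlocks₂₂ with hD
  set a : Polynomial ℂ := ((1 : Matrix (Fin n') (Fin n') (Polynomial ℂ)) +
      (Polynomial.X : Polynomial ℂ) • A.map (fun a : ℂ => Polynomial.C a)).det with ha
  have ha_eval : ∀ ξ : ℂ, a.eval ξ = (1 + ξ • A).det := schur_eval_det_one_add_X_smul A
  have ha0' : a.eval 0 ≠ 0 := by rw [ha_eval]; simp
  have ha0 : a.coeff 0 = 1 := by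
    rw [Polynomial.coeff_zero_eq_eval_zero, ha_eval]; simp
  have hadeg : a.natDegree ≤ n' := natDegree_det_one_add_X_smul_map A
  -- the bordered determinant `b` and the Schur expansion `P = â + b̂ X_{c 0}`
  obtain ⟨b, hbdeg, hbe⟩ : ∃ b : Polynomial ℂ, b.natDegree ≤ n' + 1 ∧
      ∀ ξ : ℂ, (1 + ξ • A).det ≠ 0 →
        b.eval ξ = (1 + ξ • A).det * ((D - ξ • (C * (1 + ξ • A)⁻¹ * B)).submatrix id id).det :=
    ⟨_, natDegree_bordPoly_le A B C D id, fun ξ hξ => eval_bordPoly A B C D id ξ hξ⟩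
  have hPE : P = Polynomial.aeval (MvPolynomial.X x : MvPolynomial σ ℂ) a +
      Polynomial.aeval (MvPolynomial.X x : MvPolynomial σ ℂ) b * MvPolynomial.X (c 0) := by
    rw [hP0]
    refine schur_eq_of_eval_eq x a ha0' fun z hz' => ?_
    rw [ha_eval] at hz'
    rw [schur_eval_pencil_fromBlocks x c A B C D z hz']
    simp only [map_add, map_mul, schur_eval_aeval_X, ha_eval, MvPolynomial.eval_X, hbe (z x) hz',
      Matrix.submatrix_id_id, Matrix.det_fin_one]
    simp [Matrix.diagonal_mul]
    ring
  -- (d) consequences of zero-freeness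
  have h0 : ∀ j : σ, ‖(0 : σ → ℂ) j‖ ≤ 2 := fun j => by simp
  have hevalP : ∀ z : σ → ℂ, MvPolynomial.eval z P = a.eval (z x) + b.eval (z x) * z (c 0) := by
    intro z; rw [hPE]; simp only [map_add, map_mul, schur_eval_aeval_X, MvPolynomial.eval_X]
  have ha_ne : ∀ ξ : ℂ, ‖ξ‖ ≤ 2 → a.eval ξ ≠ 0 := by
    intro ξ hξ
    have h := hz (Function.update 0 x ξ) (bnd_norm_update_le h0 x hξ)
    rw [hevalP, Function.update_self, Function.update_of_ne (hc 0)] at h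
    simpa using h
  have hb_le : ∀ ξ : ℂ, ‖ξ‖ ≤ 2 → ‖b.eval ξ‖ ≤ 1 / 2 * ‖a.eval ξ‖ := by
    intro ξ hξ
    have hl : ∀ u : ℂ, ‖u‖ ≤ 2 → a.eval ξ + b.eval ξ * u ≠ 0 := by
      intro u hu
      have h := hz (Function.update (Function.update 0 x ξ) (c 0) u)
        (bnd_norm_update_le (bnd_norm_update_le h0 x hξ) (c 0) hu)
      rwa [hevalP, Function.update_of_ne (hc 0).symm, Function.update_self,
        Function.update_self] at h
    have := bnd_norm_le_of_linear_ne_zero hl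
    linarith
  -- (e) the pieces N1 and N2 at `N = n' + 1`
  have hc1 : ∀ k : ℕ, ‖PowerSeries.coeff k ((b : PowerSeries ℂ) * (a : PowerSeries ℂ)⁻¹)‖ ≤
      (1 / 2) / 2 ^ k := hN1 a b (1 / 2) ha0 ha_ne hb_le
  obtain ⟨Cc, hCc⟩ := assembly_exists_inv_bound a ha_ne
  have hc2 : ∀ m : ℕ, ‖PowerSeries.coeff m ((a : PowerSeries ℂ)⁻¹)‖ ≤ Cc / 2 ^ m := by
    intro m
    have h := hN1 a 1 Cc ha0 ha_ne hCc m
    rwa [Polynomial.coe_one, one_mul] at h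
  obtain ⟨Gp, hGh, hGpos, hGsum, hGstein⟩ :=
    hN2 (n' + 1) a ha0 (hadeg.trans (by omega)) ⟨Cc, hc2⟩
  -- (f) `φ` = coefficient vector of `b`; `φ* Gp φ ≤ 1/2`
  set φ : Fin (n' + 1 + 2) → ℂ := fun j => b.coeff j with hφdef
  have hbsum : (∑ j : Fin (n' + 1 + 2), Polynomial.monomial (j : ℕ) (φ j) : Polynomial ℂ) = b := by
    rw [Fin.sum_univ_eq_sum_range (fun j => Polynomial.monomial j (b.coeff j)) (n' + 1 + 2)]
    exact (Polynomial.as_sum_range' b (n' + 1 + 2) (by omega)).symm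
  obtain ⟨hsumm, htsum⟩ := hGsum φ
  rw [hbsum] at hsumm htsum
  have hφ : RCLike.re (star φ ⬝ᵥ (Gp *ᵥ φ)) ≤ 1 / 2 := by
    rw [htsum, RCLike.re_to_complex, Complex.ofReal_re]
    exact assembly_tsum_le_half _ (fun k => norm_nonneg _) hc1 hsumm
  -- (g) the contraction
  obtain ⟨T, K', hT, hK'eq, hK'norm⟩ := hN3 (n' + 1) a Gp φ hGh hGpos hGstein hφ
  -- (h) its pencil determinant
  have hclaim := det_pencil_colligation x (c 0) (n' + 1) a b φ T ha0 (hadeg.trans (by omega))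
    (hbdeg.trans (by omega)) (fun j => rfl) hT
  -- (i) the final data
  refine ⟨n' + 1 + 1 + 1, ?_, K',
    fun i => Sum.elim (fun _ => x) (fun _ => c 0) (finSumFinEquiv.symm i), hK'norm, ?_⟩
  · rw [hRt]
    calc n' + 1 + 1 + 1 ≤ 16 * (n' + 1) := by omega
      _ ≤ 2 ^ ((Nat.log 2 n + 2) ^ 2) * (n' + 1) := Nat.mul_le_mul_right _ h16
  · rw [hK'eq, det_pencil_reindex finSumFinEquiv _ (Sum.elim (fun _ => x) (fun _ => c 0)), hclaim]
    exact hPE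

end Summit.ValiantsHypothesis.ValiantsHypothesis.Theorems.PriceOfContractivity.NormHalvingModelSpace
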